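import Summits.Ventures.CertifiedManyBodySolver.Rows.HomTorusSpinMagWindowGauge
import Summits.Ventures.CertifiedManyBodySolver.Rows.HomTorusTTPrimeModel
import Summits.Ventures.CertifiedManyBodySolver.Rows.TorusCeilingSectorEngine
import HarnessLib

/-!
# Spin-twisted `t–t'` torus ceiling I — the twisted `t–t'` Hamiltonian of the torus generated by `φ`

HONEST FRAMING: first certified bounds; not a superconductivity verdict; every number certified or
labelled float.
The `t–t'` analogue of `Rows/HomTorusSpinMagModel.lean` (kernel item K8 of the CAL ceiling pages):
Peierls phases PER SPECIES on BOTH hopping graphs of the torus generated by `φ : ℤ² →+ (ℤ/Nℤ)^{d'}` —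
the nearest-neighbour graph (hops `φ eᵢ`, field `A`) and the diagonal graph (hops `φ j_s = (φ ∘ D) e_s`,
field `A'`, `Rows/HomTorusTTPrimeModel.lean`):
`H_{A,A'} = homHubbardSpinMag φ A t U + homHubbardSpinMag (φ ∘ D) A' t' 0`.
For a UNIFORM spin twist `κ i σ` (Shastry–Sutherland spin-dependent twisted boundary conditions = a flat
`U(1)_↑ × U(1)_↓` connection on the torus) the diagonal hops carry the FORCED phases
`diagTwist κ s σ = χ_σ(j_s)` of the product character `χ_σ(x) = ∏ᵢ (κ i σ)^{xᵢ}` of `ℤ²`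
(`χ_σ(eᵢ) = κ i σ`), i.e. `κ 0 σ · κ 1 σ` on `j₀ = e₀ + e₁` and `κ 0 σ · (κ 1 σ)⁻¹` on `j₁ = e₀ − e₁`:
this is the spin-twisted `t–t'` torus `homHubbardSpinMagTT' φ κ t t' U` whose sector energies the CAL
twisted `t'` rows compute (4×4 AP, 3×3 AP/PA/spin-opposite, 3×5 AP carriers at `t' = −1/4`; the 14
`KERNEL ≠ CERT` cells of `report/kernel_caps.json` v10). This file: the model, Hermiticity,
`U(1)_↑ × U(1)_↓` symmetry, orbital-gauge covariance (both fields gauge with the SAME `g`), gauge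
invariance of the sector energies, spin exchange, translation covariance for uniform fields, and the
trivial-twist reduction `H_{1} = homHubbardTT' φ`.
[cite: ShastrySutherland1990] [cite: Lieb1994, eq. (1)] [cite: XuEtAl2024, eq. (1)]
[cite: FriedliVelenik2017, §3.1]
-/

noncomputable section

open Matrix Finset
open Literature.MathematicalPhysics.QuantumLattice
open Literature.MathematicalPhysics.QuantumFieldTheory hiding Site
open Literature.MathematicalPhysics.QuantumManyBody.StateRelaxation
open Literature.Probability.LatticeModels
open HubbardWave0
open scoped ComplexOrder ComplexConjugate

namespace Summit.Ventures.CertifiedManyBodySolver.Rows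

/-! ### §1. The twist character and the forced diagonal phases -/

section TwistChar

/-- **The product character of `ℤ²` per species**: `χ_σ(x) = ∏ᵢ (κ i σ)^{xᵢ}`. [folklore] -/
def twistChar (κ : Fin 2 → Fin 2 → Circle) : Site 2 → Fin 2 → Circle :=
  fun x σ => ∏ j, κ j σ ^ (x j)

/-- `χ_σ` is multiplicative. [folklore] -/
theorem twistChar_add (κ : Fin 2 → Fin 2 → Circle) (σ : Fin 2) (x y : Site 2) :
    twistChar κ (x + y) σ = twistChar κ x σ * twistChar κ y σ :=
  prod_zpow_apply_add (fun j => κ j σ) x y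

/-- `χ_σ(eᵢ) = κ i σ`. [folklore] -/
theorem twistChar_unitVec (κ : Fin 2 → Fin 2 → Circle) (i : Fin 2) (σ : Fin 2) :
    twistChar κ (unitVec i) σ = κ i σ :=
  prod_zpow_apply_unitVec (fun j => κ j σ) i

/-- **The forced diagonal phases** of a flat spin-dependent connection with direction phases `κ`:
`diagTwist κ s σ = χ_σ(j_s)` = `κ 0 σ · κ 1 σ` (`s = 0`, `j₀ = e₀ + e₁`) resp. `κ 0 σ · (κ 1 σ)⁻¹`
(`s = 1`, `j₁ = e₀ − e₁`). [cite: ShastrySutherland1990] -/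
def diagTwist (κ : Fin 2 → Fin 2 → Circle) : Fin 2 → Fin 2 → Circle :=
  fun s σ => twistChar κ (diagVec s) σ

/-- `diagTwist κ 0 σ = κ 0 σ · κ 1 σ`. [folklore] -/
theorem diagTwist_zero (κ : Fin 2 → Fin 2 → Circle) (σ : Fin 2) : diagTwist κ 0 σ = κ 0 σ * κ 1 σ := by
  simp [diagTwist, twistChar, diagVec, Fin.prod_univ_two]

/-- `diagTwist κ 1 σ = κ 0 σ · (κ 1 σ)⁻¹`. [folklore] -/
theorem diagTwist_one (κ : Fin 2 → Fin 2 → Circle) (σ : Fin 2) : diagTwist κ 1 σ = κ 0 σ * (κ 1 σ)⁻¹ := by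
  simp [diagTwist, twistChar, diagVec, Fin.prod_univ_two]

/-- The character pulled back along `D` is a character of `ℤ²` with generator values `diagTwist κ`:
multiplicativity. [folklore] -/
theorem twistChar_diagMap_add (κ : Fin 2 → Fin 2 → Circle) (σ : Fin 2) (x y : Site 2) :
    twistChar κ (diagMap (x + y)) σ = twistChar κ (diagMap x) σ * twistChar κ (diagMap y) σ := by
  rw [map_add, twistChar_add]

/-- `(χ ∘ D)_σ(e_s) = diagTwist κ s σ`. [folklore] -/
theorem twistChar_diagMap_unitVec (κ : Fin 2 → Fin 2 → Circle) (s : Fin 2) (σ : Fin 2) :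
    twistChar κ (diagMap (unitVec s)) σ = diagTwist κ s σ := by
  rw [diagMap_unitVec]
  rfl

/-- The trivial twist forces trivial diagonal phases. [folklore] -/
theorem diagTwist_one_eq (σ : Fin 2) (s : Fin 2) : diagTwist (1 : Fin 2 → Fin 2 → Circle) s σ = 1 := by
  simp [diagTwist, twistChar]

/-- Spin exchange of the direction phases exchanges the forced diagonal phases. [folklore] -/
theorem diagTwist_swap (κ : Fin 2 → Fin 2 → Circle) (s σ : Fin 2) :
    diagTwist (fun i τ => κ i (Equiv.swap (0 : Fin 2) 1 τ)) s σ = diagTwist κ s (Equiv.swap (0 : Fin 2) 1 σ) := rfl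

end TwistChar

/-! ### §2. The spin-twisted `t–t'` Hamiltonian of the torus generated by `φ` -/

section Model

variable {d' N : ℕ} [NeZero N] (φ : Site 2 →+ TorusSite d' N)

/-- Elaborate torus identities with the order-derived `DecidableEq` (the convention of the tree's
torus files `FockRelabel`, `HomTorusMagModel`, `HomTorusSpinMagModel`). -/
local instance (priority := high) instDecidableEqFermionTorusHomSpinMagTT' : DecidableEq (FermionTorus d' N) :=
  LinearOrder.toDecidableEq

/-- **Peierls `t–t'` Hubbard Hamiltonian with spin-dependent bond phases on BOTH hopping graphs** of the
torus generated by `φ`: field `A` on the `φ eᵢ`-hops, field `A'` on the `φ j_s`-hops,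
`H_{A,A'} = homHubbardSpinMag φ A t U + homHubbardSpinMag (φ ∘ D) A' t' 0`.
[cite: Lieb1994, eq. (1)] [cite: XuEtAl2024, eq. (1)] -/
def homHubbardSpinMagTT'Gen (A A' : TorusSite d' N → Fin 2 → Fin 2 → Circle) (t t' U : ℝ) :
    Matrix (Finset (Orb (FermionTorus d' N))) (Finset (Orb (FermionTorus d' N))) ℂ :=
  homHubbardSpinMag φ A t U + homHubbardSpinMag (φ.comp diagMap) A' t' 0

/-- **The spin-twisted `t–t'` torus** (uniform direction phases `κ i σ`, forced diagonal phases
`diagTwist κ`): Shastry–Sutherland spin-dependent twisted boundary conditions for the `t–t'` Hubbard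
model on the torus generated by `φ`. [cite: ShastrySutherland1990] [cite: XuEtAl2024, eq. (1)] -/
def homHubbardSpinMagTT' (κ : Fin 2 → Fin 2 → Circle) (t t' U : ℝ) :
    Matrix (Finset (Orb (FermionTorus d' N))) (Finset (Orb (FermionTorus d' N))) ℂ :=
  homHubbardSpinMagTT'Gen φ (fun _ => κ) (fun _ => diagTwist κ) t t' U

/-- Unfolding the uniform model. [folklore] -/
theorem homHubbardSpinMagTT'_eq (κ : Fin 2 → Fin 2 → Circle) (t t' U : ℝ) :
    homHubbardSpinMagTT' φ κ t t' U =
      homHubbardSpinMag φ (fun _ => κ) t U + homHubbardSpinMag (φ.comp diagMap) (fun _ => diagTwist κ) t' 0 := rfl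

/-- `H_{A,A'}` is Hermitian. [cite: Lieb1994, eq. (1)] -/
theorem homHubbardSpinMagTT'Gen_isHermitian (A A' : TorusSite d' N → Fin 2 → Fin 2 → Circle) (t t' U : ℝ) :
    (homHubbardSpinMagTT'Gen φ A A' t t' U).IsHermitian :=
  (homHubbardSpinMag_isHermitian φ A t U).add (homHubbardSpinMag_isHermitian _ A' t' 0)

/-- The spin-twisted `t–t'` torus Hamiltonian is Hermitian. [cite: ShastrySutherland1990] -/
theorem homHubbardSpinMagTT'_isHermitian (κ : Fin 2 → Fin 2 → Circle) (t t' U : ℝ) :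
    (homHubbardSpinMagTT' φ κ t t' U).IsHermitian :=
  homHubbardSpinMagTT'Gen_isHermitian φ _ _ t t' U

/-- `[H_{A,A'}, N̂] = 0`. [cite: Lieb1994, eq. (1)] -/
theorem homHubbardSpinMagTT'Gen_commute_totalNumber (A A' : TorusSite d' N → Fin 2 → Fin 2 → Circle) (t t' U : ℝ) :
    Commute (homHubbardSpinMagTT'Gen φ A A' t t' U) (totalNumber : Matrix (Finset (Orb (FermionTorus d' N))) _ ℂ) :=
  (homHubbardSpinMag_commute_totalNumber φ A t U).add_left (homHubbardSpinMag_commute_totalNumber _ A' t' 0)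

/-- `[H_{A,A'}, S^z] = 0`. [cite: Lieb1994, eq. (1)] -/
theorem homHubbardSpinMagTT'Gen_commute_spinZ (A A' : TorusSite d' N → Fin 2 → Fin 2 → Circle) (t t' U : ℝ) :
    Commute (homHubbardSpinMagTT'Gen φ A A' t t' U)
      (HubbardWave0.spinZ : Matrix (Finset (Orb (FermionTorus d' N))) _ ℂ) :=
  (homHubbardSpinMag_commute_spinZ φ A t U).add_left (homHubbardSpinMag_commute_spinZ _ A' t' 0)

/-- `H_{A,A'}` preserves every joint sector `(N, S^z)`. [cite: Lieb1994, eq. (1)] -/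
theorem mulVec_homHubbardSpinMagTT'Gen_mem_szSector (A A' : TorusSite d' N → Fin 2 → Fin 2 → Circle) (t t' U : ℝ)
    {n : ℕ} {M : ℝ} {ψ : Fock (Orb (FermionTorus d' N))} (hψ : ψ ∈ szSector n M) :
    homHubbardSpinMagTT'Gen φ A A' t t' U *ᵥ ψ ∈ szSector n M :=
  mulVec_mem_szSector_of_commute (homHubbardSpinMagTT'Gen_commute_totalNumber φ A A' t t' U)
    (homHubbardSpinMagTT'Gen_commute_spinZ φ A A' t t' U) hψ

/-- `[H_κ^{tt'}, N̂] = 0`. [cite: ShastrySutherland1990] -/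
theorem homHubbardSpinMagTT'_commute_totalNumber (κ : Fin 2 → Fin 2 → Circle) (t t' U : ℝ) :
    Commute (homHubbardSpinMagTT' φ κ t t' U) (totalNumber : Matrix (Finset (Orb (FermionTorus d' N))) _ ℂ) :=
  homHubbardSpinMagTT'Gen_commute_totalNumber φ _ _ t t' U

/-- `[H_κ^{tt'}, S^z] = 0`. [cite: ShastrySutherland1990] -/
theorem homHubbardSpinMagTT'_commute_spinZ (κ : Fin 2 → Fin 2 → Circle) (t t' U : ℝ) :
    Commute (homHubbardSpinMagTT' φ κ t t' U) (HubbardWave0.spinZ : Matrix (Finset (Orb (FermionTorus d' N))) _ ℂ) :=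
  homHubbardSpinMagTT'Gen_commute_spinZ φ _ _ t t' U

/-- `H_κ^{tt'}` preserves every joint sector `(N, S^z)`. [cite: ShastrySutherland1990] -/
theorem mulVec_homHubbardSpinMagTT'_mem_szSector (κ : Fin 2 → Fin 2 → Circle) (t t' U : ℝ)
    {n : ℕ} {M : ℝ} {ψ : Fock (Orb (FermionTorus d' N))} (hψ : ψ ∈ szSector n M) :
    homHubbardSpinMagTT' φ κ t t' U *ᵥ ψ ∈ szSector n M :=
  mulVec_homHubbardSpinMagTT'Gen_mem_szSector φ _ _ t t' U hψ

/-! ### §3. Covariance under the orbital gauge `W_g`, `g : site × spin → U(1)` (one `g` for both graphs) -/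

/-- **`H_{g·A, g·A'} = W_gᴴ H_{A,A'} W_g`**: both bond fields gauge with the same orbital phase function.
[cite: Lieb1994, eq. (1)] -/
theorem homHubbardSpinMagTT'Gen_homSpinGaugeTransform (g : TorusSite d' N → Fin 2 → Circle)
    (A A' : TorusSite d' N → Fin 2 → Fin 2 → Circle) (t t' U : ℝ) :
    homHubbardSpinMagTT'Gen φ (homSpinGaugeTransform φ g A) (homSpinGaugeTransform (φ.comp diagMap) g A') t t' U =
      (orbPhaseGauge (spinSitePhase g))ᴴ * homHubbardSpinMagTT'Gen φ A A' t t' U *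
        orbPhaseGauge (spinSitePhase g) := by
  rw [homHubbardSpinMagTT'Gen, homHubbardSpinMagTT'Gen, homHubbardSpinMag_homSpinGaugeTransform,
    homHubbardSpinMag_homSpinGaugeTransform, Matrix.mul_add, Matrix.add_mul]

/-- `Ad(W_g) H_{g·A, g·A'} = H_{A,A'}`. [cite: Lieb1994, eq. (1)] -/
theorem orbGaugeAut_homHubbardSpinMagTT'Gen_homSpinGaugeTransform (g : TorusSite d' N → Fin 2 → Circle)
    (A A' : TorusSite d' N → Fin 2 → Fin 2 → Circle) (t t' U : ℝ) :
    orbGaugeAut (spinSitePhase g)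
        (homHubbardSpinMagTT'Gen φ (homSpinGaugeTransform φ g A) (homSpinGaugeTransform (φ.comp diagMap) g A') t t' U) =
      homHubbardSpinMagTT'Gen φ A A' t t' U := by
  rw [homHubbardSpinMagTT'Gen, homHubbardSpinMagTT'Gen, map_add (orbGaugeAut (spinSitePhase g)),
    orbGaugeAut_homHubbardSpinMag_homSpinGaugeTransform, orbGaugeAut_homHubbardSpinMag_homSpinGaugeTransform]

/-- **Gauge invariance of the sector energies**: `H_{g·A, g·A'}` and `H_{A,A'}` have the same lowest energy
in every joint sector `(N, S^z)`. [cite: Lieb1994, eq. (1)] -/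
theorem minEnergyOn_szSector_homHubbardSpinMagTT'Gen_homSpinGaugeTransform (g : TorusSite d' N → Fin 2 → Circle)
    (A A' : TorusSite d' N → Fin 2 → Fin 2 → Circle) (t t' U : ℝ) (n : ℕ) (M : ℝ) :
    (homHubbardSpinMagTT'Gen φ (homSpinGaugeTransform φ g A) (homSpinGaugeTransform (φ.comp diagMap) g A')
        t t' U).minEnergyOn (szSector n M) =
      (homHubbardSpinMagTT'Gen φ A A' t t' U).minEnergyOn (szSector n M) := by
  rw [homHubbardSpinMagTT'Gen_homSpinGaugeTransform]
  exact minEnergyOn_szSector_orbPhaseGauge_conj _ _ n M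

/-- A gauge transformation CONSTANT IN SPACE (one phase per species) commutes with `H_{A,A'}`.
[cite: Lieb1994, eq. (1)] -/
theorem orbPhaseGauge_constSpin_mul_homHubbardSpinMagTT'Gen (c : Fin 2 → Circle)
    (A A' : TorusSite d' N → Fin 2 → Fin 2 → Circle) (t t' U : ℝ) :
    orbPhaseGauge (spinSitePhase (fun _ : TorusSite d' N => c)) * homHubbardSpinMagTT'Gen φ A A' t t' U =
      homHubbardSpinMagTT'Gen φ A A' t t' U * orbPhaseGauge (spinSitePhase (fun _ : TorusSite d' N => c)) := by
  rw [homHubbardSpinMagTT'Gen, Matrix.mul_add, Matrix.add_mul, orbPhaseGauge_constSpin_mul_homHubbardSpinMag,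
    orbPhaseGauge_constSpin_mul_homHubbardSpinMag]

/-! ### §4. Spin exchange, translations, trivial twist -/

/-- **Spin exchange maps `H_{A,A'}` to `H_{Ā,Ā'}`** (`Ā x i σ = A x i σ̄`).
[cite: LiebPRL1989, proof of Theorem 1] -/
theorem relabel_spinSwap_homHubbardSpinMagTT'Gen (A A' : TorusSite d' N → Fin 2 → Fin 2 → Circle) (t t' U : ℝ) :
    relabel (Orb.spinSwap : Orb (FermionTorus d' N) ≃ Orb (FermionTorus d' N)) (homHubbardSpinMagTT'Gen φ A A' t t' U) =
      homHubbardSpinMagTT'Gen φ (fun x i σ => A x i (Equiv.swap (0 : Fin 2) 1 σ))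
        (fun x i σ => A' x i (Equiv.swap (0 : Fin 2) 1 σ)) t t' U := by
  rw [homHubbardSpinMagTT'Gen, relabel_add, relabel_spinSwap_homHubbardSpinMag, relabel_spinSwap_homHubbardSpinMag]
  rfl

/-- **Spin exchange on the spin-twisted `t–t'` torus**: `Γ H_κ Γ⁻¹ = H_{κ̄}`, `κ̄ i σ = κ i σ̄` (the forced
diagonal phases exchange with the direction phases). [cite: LiebPRL1989, proof of Theorem 1] -/
theorem relabel_spinSwap_homHubbardSpinMagTT' (κ : Fin 2 → Fin 2 → Circle) (t t' U : ℝ) :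
    relabel (Orb.spinSwap : Orb (FermionTorus d' N) ≃ Orb (FermionTorus d' N)) (homHubbardSpinMagTT' φ κ t t' U) =
      homHubbardSpinMagTT' φ (fun i σ => κ i (Equiv.swap (0 : Fin 2) 1 σ)) t t' U := by
  rw [homHubbardSpinMagTT', relabel_spinSwap_homHubbardSpinMagTT'Gen]
  rfl

/-- **`E_{κ̄}(b, a) = E_κ(a, b)`** for the spin-twisted `t–t'` torus. [cite: LiebPRL1989, proof of Theorem 1] -/
theorem minEnergyOn_homHubbardSpinMagTT'_spinSwap (κ : Fin 2 → Fin 2 → Circle) (t t' U : ℝ) (a b : ℕ) :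
    (homHubbardSpinMagTT' φ (fun i σ => κ i (Equiv.swap (0 : Fin 2) 1 σ)) t t' U).minEnergyOn
        (szSector (b + a) (((b : ℝ) - a) / 2)) =
      (homHubbardSpinMagTT' φ κ t t' U).minEnergyOn (szSector (a + b) (((a : ℝ) - b) / 2)) := by
  rw [add_comm b a, show ((b : ℝ) - a) / 2 = -(((a : ℝ) - b) / 2) by ring]
  exact minEnergyOn_szSector_neg_of_relabel_spinSwap (relabel_spinSwap_homHubbardSpinMagTT' φ κ t t' U) _ _

/-- **Translation covariance** for translation-invariant fields on both graphs. [cite: FriedliVelenik2017, §3.1] -/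
theorem relabel_translate_homHubbardSpinMagTT'Gen (v : TorusSite d' N) (A A' : TorusSite d' N → Fin 2 → Fin 2 → Circle)
    (hA : ∀ x i, A (x + v) i = A x i) (hA' : ∀ x i, A' (x + v) i = A' x i) (t t' U : ℝ) :
    relabel (Orb.translate v) (homHubbardSpinMagTT'Gen φ A A' t t' U) = homHubbardSpinMagTT'Gen φ A A' t t' U := by
  rw [homHubbardSpinMagTT'Gen, relabel_add, relabel_translate_homHubbardSpinMag φ v A hA,
    relabel_translate_homHubbardSpinMag _ v A' hA']

/-- The torus translations commute with the spin-twisted `t–t'` torus Hamiltonian (uniform fields).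
[cite: FriedliVelenik2017, §3.1] -/
theorem fockTranslate_mul_homHubbardSpinMagTT' (v : TorusSite d' N) (κ : Fin 2 → Fin 2 → Circle) (t t' U : ℝ) :
    (fockTranslate v).val * homHubbardSpinMagTT' φ κ t t' U =
      homHubbardSpinMagTT' φ κ t t' U * (fockTranslate v).val := by
  rw [homHubbardSpinMagTT'_eq, Matrix.mul_add, Matrix.add_mul, fockTranslate_mul_homHubbardSpinMag_const,
    fockTranslate_mul_homHubbardSpinMag_const]

/-- **Trivial twist**: `H_1^{tt'} = homHubbardTT' φ` for non-degenerate nearest-neighbour and diagonal hops.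
[cite: XuEtAl2024, eq. (1)] -/
theorem homHubbardSpinMagTT'_one_eq_homHubbardTT' (hd : Function.Injective (signedHop φ))
    (hd' : Function.Injective (signedHop (φ.comp diagMap))) (t t' U : ℝ) :
    homHubbardSpinMagTT' φ 1 t t' U = homHubbardTT' φ t t' U := by
  have h1 : (fun _ : TorusSite d' N => diagTwist (1 : Fin 2 → Fin 2 → Circle)) = 1 := by
    funext x s σ
    exact diagTwist_one_eq σ s
  rw [homHubbardSpinMagTT'_eq, h1, show (fun _ : TorusSite d' N => (1 : Fin 2 → Fin 2 → Circle)) = 1 from rfl,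
    homHubbardSpinMag_one_eq_homHubbard φ hd, homHubbardSpinMag_one_eq_homHubbard _ hd', homHubbardTT']

/-- **Spin-blind uniform twist** (the same phase for both species = a FLUX / Peierls twist of the `t–t'`
torus, diagonal fluxes forced): `H_κ^{tt'}` with `κ i σ = κ' i` is the sum of two Peierls Hamiltonians of
Part VI. Recorded as the special case it is. [cite: Lieb1994, eq. (1)] -/
theorem homHubbardSpinMagTT'_spinBlind (κ' : Fin 2 → Circle) (t t' U : ℝ) :
    homHubbardSpinMagTT' φ (fun i _ => κ' i) t t' U =
      homHubbardMag φ (fun _ i => κ' i) t U +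
        homHubbardMag (φ.comp diagMap) (fun _ s => diagTwist (fun i _ => κ' i) s 0) t' 0 := rfl

end Model

end Summit.Ventures.CertifiedManyBodySolver.Rows

end
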